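import Summits.ValiantsHypothesis.ValiantsHypothesis.Theorems.VPBoundarySquareBorderDepthAlder
import Summits.ValiantsHypothesis.ValiantsHypothesis.Theorems.DecompCycle1CPerBorderConstDepth
import HarnessLib

/-!
# Route `VPBoundarySquare` — the border dial at CONSTANT product-depth: `Ā_{Δ₀}` holds, `B̄_{Δ₀} ↔ VH`

Decomp-valiant workshop, lens 3 «border-complexity / debordering axis», generation 30; census cell V28, leaf.
Unconditional, 0 sorry, no named fact; calibration of the lens-3 record (`VPBoundarySquareBorderTransfer.lean`):
it does NOT prove `VP ≠ VNP`, moves no tag, closes no crux.  Kept apart from the route-independent bridge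
`VPBoundarySquareBorderDepthAlder.lean` because V27 (`DecompCycle1CPerBorderConstDepth.lean`, the `ε`-border
constant-depth permanent bound) imports the route file `Theses/DecompCycle1C.lean` (theses-cone hygiene).

WHAT IS PROVED (all kernel; `Δ₀` a constant):
* ★ `not_perInBorderDepthPoly_const`: **`Ā_{Δ₀}`** — the permanent family is NOT in the Zariski border `D̄` of
  p-bounded-wire product-depth-`Δ₀` circuits over `ℂ`: V27 (`per ∉` the `ε`-border, from the border
  Limaye–Srinivasan–Tavenas bound of Andrews–Forbes 2022 Cor. 6.5 moved to `per` by VNP-completeness and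
  projection-stability) through the currency bridge `not_perInBorderDepthPoly_iff_borderHard` (Alder–Strassen /
  Bürgisser 2004 Thm. 2.2 for the wires × product-depth class).
* `not_perInDepthPoly_const`: hence the exact bound `A_{Δ₀}` (lens 4's `perHardConstDepth`) once more, via `Ā → A`.
* `per_certificates_constDepth`: equation certificates (polynomials in the coefficients vanishing on the class,
  not at `per_n`) exist at every polynomial wire budget (`not_perInBorderDepthPoly_iff_certificates`).
* `dial_constDepth`: the constant-depth dial sits in case (iii) of `dial_trichotomy` — `per` is NOT a boundary
  family of any constant-product-depth class (the phenomenon `M`/`BoundaryOfVPNonempty` of the square does not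
  occur at constant depth for `per`).
* `collapseToBorderDepth_const_iff_vh`: **`B̄_{Δ₀} ↔ VH`** — at constant depth the border residual is literally the
  summit (zero-sum reading of the dial, kernel: sliding the dial to any constant depth buys nothing).

Print status: the border constant-depth bound is Andrews–Forbes 2022 Cor. 6.5 (for IMM / det; for `per` by
completeness, folklore); its Zariski-closure form is folklore of GCT given Alder–Strassen.  Nothing here bears on
growing depth or on `VP ≠ VNP`.

References: [AndrewsForbes2022] Cor. 6.5; [Burgisser2004Factors] Thm. 2.2; [BurgisserEtAl2011] §9.3;
[LimayeSrinivasanTavenas2025] Cor. 4.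
-/

-- layout Summits/ValiantsHypothesis/ValiantsHypothesis forces the duplicated namespace component
set_option linter.dupNamespace false

namespace Summit.ValiantsHypothesis.ValiantsHypothesis.Theorems.VPBoundarySquare

open MvPolynomial Literature.Computability.AlgebraicComplexity ArithCircuit

noncomputable section

/-- ★ **`Ā_{Δ₀}` for every constant product-depth `Δ₀`**: the permanent family is NOT in the (Zariski) border of
p-bounded-wire product-depth-`Δ₀` circuits — V27 (`perPoly_not_mem_borderClass_constDepth`, the border LST /
Andrews–Forbes Cor. 6.5 bound moved to `per`) in the dial's own currency. [cite: AndrewsForbes2022, Cor. 6.5] -/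
theorem not_perInBorderDepthPoly_const (Δ₀ : ℕ) : ¬ PerInBorderDepthPoly (fun _ => Δ₀) :=
  (not_perInBorderDepthPoly_iff_borderHard fun _ => Δ₀).2
    (DecompCycle1CPerBorderConstDepth.perPoly_not_mem_borderClass_constDepth Δ₀)

/-- Hence `A_{Δ₀}` (the exact constant-depth bound, lens 4's `perHardConstDepth`) once more, via `Ā → A`.
[cite: LimayeSrinivasanTavenas2025, Cor. 4] -/
theorem not_perInDepthPoly_const (Δ₀ : ℕ) : ¬ PerInDepthPoly (fun _ => Δ₀) :=
  perHardAtDepth_of_perBorderHardAtDepth (not_perInBorderDepthPoly_const Δ₀)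

/-- **Equation certificates against `per` exist at constant depth, at every polynomial budget** (transfer iff of
the record file). [cite: BurgisserEtAl2011, §9.3] -/
theorem per_certificates_constDepth (Δ₀ c : ℕ) :
    ∃ n : ℕ, ∃ Q : MvPolynomial ((Fin n × Fin n) →₀ ℕ) ℂ,
      (∀ g ∈ DepthClass (Fin n × Fin n) Δ₀ (n ^ c + c), aeval (coeffVec g) Q = 0) ∧
        aeval (coeffVec (perPoly (Fin n) ℂ)) Q ≠ 0 :=
  (not_perInBorderDepthPoly_iff_certificates fun _ => Δ₀).1 (not_perInBorderDepthPoly_const Δ₀) c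

/-- **The dial at constant depth sits in case (iii) of `dial_trichotomy`**: `A_{Δ₀} ∧ Ā_{Δ₀}` — in particular
`per` is NOT a boundary family of any constant-product-depth class (case (ii) is excluded). [folklore] -/
theorem dial_constDepth (Δ₀ : ℕ) :
    ¬ PerInDepthPoly (fun _ => Δ₀) ∧ ¬ PerInBorderDepthPoly (fun _ => Δ₀) :=
  ⟨not_perInDepthPoly_const Δ₀, not_perInBorderDepthPoly_const Δ₀⟩

/-- **At constant depth the border residual is literally the summit**: `B̄_{Δ₀} ↔ VH` (since `Ā_{Δ₀}` holds
and `B̄ ↔ (Ā → VH)`): the zero-sum reading of the constant-depth dial, kernel. [folklore] -/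
theorem collapseToBorderDepth_const_iff_vh (Δ₀ : ℕ) :
    (VP ℂ = VNP ℂ → PerInBorderDepthPoly (fun _ => Δ₀)) ↔ _root_.ValiantsHypothesis := by
  rw [collapseToBorderDepth_iff_residual]
  exact ⟨fun h => h (not_perInBorderDepthPoly_const Δ₀), fun h _ => h⟩

end

end Summit.ValiantsHypothesis.ValiantsHypothesis.Theorems.VPBoundarySquare
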